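import Summits.CriticalPhenomena.PercolationContinuityZ3.Theorems.PercNearOneGluingNoHeavyLowerTailSahiSliceMinimum
import Literature.Combinatorics.Sahi2008.PushForward

/-!
# `NoHeavyLowerTail` (crux stmt-CriticalPhenomena-4575), Sahi programme P2 (gen 17): THE SLICE MINIMUM PRINCIPLE IS
# SELF-IMPROVING — the OR-blow-up (composition) reduction

Support file (`--supports stmt-CriticalPhenomena-4575`; companion of `…SahiSliceMinimum`, P2 gen 16).  Everything here is
PROVED (no `sorry`, standard axioms); the only conjecture mentioned is the tree's `SahiSliceMinimum.SliceMinimumPrinciple`,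
which appears as a HYPOTHESIS.

THE CONSTRUCTION.  Double the coin set, `ι ↦ ι ⊕ ι`, give the two copies of coin `i` the biases `r_i` and `r'_i`, and pull every
event back along the OR-JOIN `ω' ↦ {i | inl i ∈ ω' ∨ inr i ∈ ω'}` (`orJoin`, `orLift`; increasing events stay increasing).  If
`(1 − r_i)(1 − r'_i) = 1 − p_i` for every `i`, the push-forward of the doubled product weight along the OR-join is the product
weight `μ_p` (`pushWeight_orJoin`: the union of independent `Bern(r)` and `Bern(r')` random sets is `Bern(p)`), so every Sahi
functional of the lifted family equals that of the original family (`sahiE_orLift`, via the tree's `sahiE_pushWeight`).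
Freezing ONE of the two copies of coin `e` at `1` turns the macro-bias of `e` into `1`; freezing it at `0` turns it into the
OTHER copy's bias (`r'_e`, resp. `r_e`) — an INTERIOR point of the fibre of `E₃` along `e` (`orLift_update_inl_one`, `…_zero`, …).

THE THEOREM (`orSlice_of_sliceMinimumPrinciple`).  `SliceMinimumPrinciple 3` implies, for every triple of increasing events on
a cube with all biases in `(0,1)` and every choice of splittings `(1 − r_e)(1 − r'_e) = 1 − p_e` with `r_e, r'_e ∈ (0,1)`:
  **some coin `e` has `E₃(μ_{p[e↦1]}) ≤ E₃(μ_p)` or `E₃(μ_{p[e↦r_e]}) ≤ E₃(μ_p)` or `E₃(μ_{p[e↦r'_e]}) ≤ E₃(μ_p)`.**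
For `r_e → p_e⁻` (so `r'_e → 0⁺`) this is the paper-level GRADIENT SLICE PRINCIPLE of this generation ("some axis has its top facet
below `E₃`, or its bottom facet below `E₃` while `E₃` is non-decreasing in that bias"), strictly stronger than the slice minimum
principle itself at the same number of coins: the principle is SELF-IMPROVING under composition with monotone gadgets (memo
`FROM-prim-masterthm-p2-g17-BLOWUP.md`, SAHI-ROUTE §4.41).  USE: a violation of the conclusion on few coins refutes
`SliceMinimumPrinciple 3` through this file.  HONEST LABEL: a reduction between statements; Kahn's `C₃` remains OPEN.
-/

noncomputable section

open scoped Classical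

namespace Summit.CriticalPhenomena.PercolationContinuityZ3.Theorems

open Finset Function
open Literature.Combinatorics.Sahi2008
open Literature.Probability.Percolation.DecisionTree (ind ind_of_mem ind_of_not_mem ind_nonneg)

namespace SahiSliceMinimum

variable {ι : Type} [Fintype ι]

/-! ### The OR-join of the doubled coin set -/

/-- The OR-join `ω' ↦ {i | inl i ∈ ω' ∨ inr i ∈ ω'}` of a configuration of the doubled coin set `ι ⊕ ι`. [this work] -/
def orJoin (ω : Set (ι ⊕ ι)) : Set ι := {i | Sum.inl i ∈ ω ∨ Sum.inr i ∈ ω}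

omit [Fintype ι] in
/-- Membership in the OR-join. [this work] -/
theorem mem_orJoin (ω : Set (ι ⊕ ι)) (i : ι) : i ∈ orJoin ω ↔ Sum.inl i ∈ ω ∨ Sum.inr i ∈ ω := Iff.rfl

omit [Fintype ι] in
/-- The OR-join is monotone. [this work] -/
theorem orJoin_mono {ω₁ ω₂ : Set (ι ⊕ ι)} (h : ω₁ ⊆ ω₂) : orJoin ω₁ ⊆ orJoin ω₂ := by
  intro i hi
  rcases hi with h1 | h2
  · exact Or.inl (h h1)
  · exact Or.inr (h h2)

/-- The OR-lift of an event: `ω'` belongs to it iff its OR-join belongs to `U`. [this work] -/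
def orLift (U : Set (Set ι)) : Set (Set (ι ⊕ ι)) := {ω | orJoin ω ∈ U}

omit [Fintype ι] in
/-- The OR-lift of an increasing event is increasing. [this work] -/
theorem isUpperSet_orLift {U : Set (Set ι)} (hU : IsUpperSet U) : IsUpperSet (orLift U) :=
  fun _ _ h hω => hU (orJoin_mono h) hω

omit [Fintype ι] in
/-- The indicator of the OR-lift is the pulled-back indicator. [this work] -/
theorem ind_orLift (U : Set (Set ι)) : ind (orLift U) = ind U ∘ orJoin := by
  funext ω
  simp only [Function.comp_apply]
  by_cases h : orJoin ω ∈ U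
  · rw [ind_of_mem h, ind_of_mem (show ω ∈ orLift U from h)]
  · rw [ind_of_not_mem h, ind_of_not_mem (show ω ∉ orLift U from h)]

/-! ### The push-forward of the doubled product weight along the OR-join -/

/-- Configurations of the doubled coin set as pairs of bits per coin. [this work] -/
def pairEquiv : (ι → Bool × Bool) ≃ Set (ι ⊕ ι) where
  toFun g := {x | Sum.elim (fun i => (g i).1 = true) (fun i => (g i).2 = true) x}
  invFun ω := fun i => (decide (Sum.inl i ∈ ω), decide (Sum.inr i ∈ ω))
  left_inv g := by
    funext i
    ext <;> simp
  right_inv ω := by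
    ext x
    cases x <;> simp

omit [Fintype ι] in
/-- Membership of a left copy in `pairEquiv g`. [this work] -/
theorem inl_mem_pairEquiv (g : ι → Bool × Bool) (i : ι) : Sum.inl i ∈ pairEquiv g ↔ (g i).1 = true := Iff.rfl

omit [Fintype ι] in
/-- Membership of a right copy in `pairEquiv g`. [this work] -/
theorem inr_mem_pairEquiv (g : ι → Bool × Bool) (i : ι) : Sum.inr i ∈ pairEquiv g ↔ (g i).2 = true := Iff.rfl

omit [Fintype ι] in
/-- The OR-join of `pairEquiv g` is `{i | (g i).1 || (g i).2}`. [this work] -/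
theorem mem_orJoin_pairEquiv (g : ι → Bool × Bool) (i : ι) : i ∈ orJoin (pairEquiv g) ↔ ((g i).1 || (g i).2) = true := by
  rw [mem_orJoin, inl_mem_pairEquiv, inr_mem_pairEquiv, Bool.or_eq_true]

/-- The local factor of the doubled weight at coin `i`. [this work] -/
def locFactor (r r' : ι → unitInterval) (i : ι) (z : Bool × Bool) : ℝ :=
  (if z.1 = true then (r i : ℝ) else 1 - r i) * (if z.2 = true then (r' i : ℝ) else 1 - r' i)

/-- The doubled product weight factorises coin by coin over the pairs of bits. [this work] -/
theorem bernoulliWeight_pairEquiv (r r' : ι → unitInterval) (g : ι → Bool × Bool) :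
    bernoulliWeight (Sum.elim r r') (pairEquiv g) = ∏ i, locFactor r r' i (g i) := by
  show Literature.Probability.Percolation.BHK2006.weight _ _ = _
  unfold Literature.Probability.Percolation.BHK2006.weight
  rw [Fintype.prod_sum_type, ← prod_mul_distrib]
  refine prod_congr rfl fun i _ => ?_
  simp only [Sum.elim_inl, Sum.elim_inr, locFactor]
  congr 1
  · by_cases h : (g i).1 = true
    · rw [if_pos h, if_pos ((inl_mem_pairEquiv g i).2 h)]
    · rw [if_neg h, if_neg (fun hm => h ((inl_mem_pairEquiv g i).1 hm))]
  · by_cases h : (g i).2 = true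
    · rw [if_pos h, if_pos ((inr_mem_pairEquiv g i).2 h)]
    · rw [if_neg h, if_neg (fun hm => h ((inr_mem_pairEquiv g i).1 hm))]

omit [Fintype ι] in
/-- The local sum over the pairs of bits compatible with a prescribed join value. [this work] -/
theorem sum_locFactor_filter (r r' p : ι → unitInterval) (h : ∀ i, (1 - (r i : ℝ)) * (1 - r' i) = 1 - p i) (i : ι) (c : Bool) :
    ∑ z : Bool × Bool, (if ((z.1 || z.2) = c) then locFactor r r' i z else 0) = if c = true then (p i : ℝ) else 1 - p i := by
  have hi := h i
  rw [Fintype.sum_prod_type]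
  cases c <;>
    simp only [Fintype.sum_bool, locFactor, Bool.or_true, Bool.or_false, if_true,
      Bool.false_eq_true, if_false, Bool.true_eq_false] <;>
    linarith

/-- **The union of independent `Bern(r)` and `Bern(r')` random sets is `Bern(p)`** when `(1 − r_i)(1 − r'_i) = 1 − p_i`: the push-forward of
the doubled product weight along the OR-join is the product weight `μ_p`. [folklore] -/
theorem pushWeight_orJoin (r r' p : ι → unitInterval) (h : ∀ i, (1 - (r i : ℝ)) * (1 - r' i) = 1 - p i) :
    pushWeight (bernoulliWeight (Sum.elim r r')) orJoin = bernoulliWeight p := by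
  funext ω
  rw [pushWeight_apply]
  -- reindex the configurations of the doubled coin set by pairs of bits per coin
  rw [← (pairEquiv (ι := ι)).sum_comp]
  have hsummand : ∀ g : ι → Bool × Bool,
      (if orJoin (pairEquiv g) = ω then bernoulliWeight (Sum.elim r r') (pairEquiv g) else 0) =
        ∏ i, (if (((g i).1 || (g i).2) = decide (i ∈ ω)) then locFactor r r' i (g i) else 0) := by
    intro g
    by_cases hg : orJoin (pairEquiv g) = ω
    · rw [if_pos hg, bernoulliWeight_pairEquiv]
      refine prod_congr rfl fun i _ => ?_
      have : ((g i).1 || (g i).2) = decide (i ∈ ω) := by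
        have hiff : ((g i).1 || (g i).2) = true ↔ i ∈ ω := by rw [← mem_orJoin_pairEquiv, hg]
        by_cases hω : i ∈ ω
        · rw [decide_eq_true hω]; exact hiff.2 hω
        · rw [decide_eq_false hω]; exact Bool.eq_false_iff.2 (fun ht => hω (hiff.1 ht))
      rw [if_pos this]
    · rw [if_neg hg]
      -- some coin has the wrong join value, so its factor vanishes
      have hex : ∃ i, ¬ (((g i).1 || (g i).2) = decide (i ∈ ω)) := by
        by_contra hall
        push Not at hall
        apply hg
        ext i
        rw [mem_orJoin_pairEquiv, hall i]
        exact decide_eq_true_iff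
      obtain ⟨i, hi⟩ := hex
      exact (prod_eq_zero (mem_univ i) (if_neg hi)).symm
  simp_rw [hsummand]
  -- sum of products of local terms = product of local sums
  set Fl : ι → Bool × Bool → ℝ := fun i z => if ((z.1 || z.2) = decide (i ∈ ω)) then locFactor r r' i z else 0 with hFl
  have hswap : ∑ g : ι → Bool × Bool, ∏ i, Fl i (g i) = ∏ i, ∑ z ∈ (univ : Finset (Bool × Bool)), Fl i z := by
    rw [prod_univ_sum, Fintype.piFinset_univ]
  rw [hswap]
  show ∏ i, ∑ z ∈ (univ : Finset (Bool × Bool)), Fl i z = Literature.Probability.Percolation.BHK2006.weight _ ω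
  unfold Literature.Probability.Percolation.BHK2006.weight
  refine prod_congr rfl fun i _ => ?_
  rw [hFl]
  rw [sum_locFactor_filter r r' p h i (decide (i ∈ ω))]
  by_cases hω : i ∈ ω
  · rw [decide_eq_true hω, if_pos rfl, if_pos hω]
  · rw [decide_eq_false hω, if_neg Bool.false_ne_true, if_neg hω]

/-- **The OR-lift changes no Sahi functional**: `E_n` of the lifted family under the doubled product weight equals `E_n` of the
original family under `μ_p`. [this work] -/
theorem sahiE_orLift (r r' p : ι → unitInterval) (h : ∀ i, (1 - (r i : ℝ)) * (1 - r' i) = 1 - p i) (n : ℕ)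
    (U : Fin n → Set (Set ι)) :
    sahiE (bernoulliWeight (Sum.elim r r')) n (fun j => ind (orLift (U j))) =
      sahiE (bernoulliWeight p) n (fun j => ind (U j)) := by
  rw [← pushWeight_orJoin r r' p h, sahiE_pushWeight]
  simp only [ind_orLift]

/-! ### Freezing one copy of a coin -/

omit [Fintype ι] in
/-- Freezing the left copy of `e` at bias `b`: the compatibility relation holds with `p` replaced by `p[e ↦ 1 − (1−b)(1−r'_e)]`;
used with `b = 1` (macro-bias `1`) and `b = 0` (macro-bias `r'_e`). [this work] -/
theorem compat_update_inl (r r' p : ι → unitInterval) (h : ∀ i, (1 - (r i : ℝ)) * (1 - r' i) = 1 - p i) (e : ι)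
    (b c : unitInterval) (hbc : (1 - (b : ℝ)) * (1 - r' e) = 1 - c) :
    ∀ i, (1 - (update r e b i : ℝ)) * (1 - r' i) = 1 - update p e c i := by
  intro i
  by_cases hie : i = e
  · subst hie
    rw [update_self, update_self]
    exact hbc
  · rw [update_of_ne hie, update_of_ne hie]
    exact h i

omit [Fintype ι] in
/-- Freezing the right copy of `e` at bias `b`. [this work] -/
theorem compat_update_inr (r r' p : ι → unitInterval) (h : ∀ i, (1 - (r i : ℝ)) * (1 - r' i) = 1 - p i) (e : ι)
    (b c : unitInterval) (hbc : (1 - (r e : ℝ)) * (1 - b) = 1 - c) :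
    ∀ i, (1 - (r i : ℝ)) * (1 - update r' e b i) = 1 - update p e c i := by
  intro i
  by_cases hie : i = e
  · subst hie
    rw [update_self, update_self]
    exact hbc
  · rw [update_of_ne hie, update_of_ne hie]
    exact h i

/-- `E₃` of the lifted triple with the LEFT copy of `e` frozen at `b ∈ [0,1]` is `E₃` of the original triple at
`p[e ↦ c]`, `1 − c = (1 − b)(1 − r'_e)`. [this work] -/
theorem sahiE_orLift_update_inl (r r' p : ι → unitInterval) (h : ∀ i, (1 - (r i : ℝ)) * (1 - r' i) = 1 - p i) (e : ι)
    (b c : unitInterval) (hbc : (1 - (b : ℝ)) * (1 - r' e) = 1 - c) (n : ℕ) (U : Fin n → Set (Set ι)) :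
    sahiE (bernoulliWeight (update (Sum.elim r r') (Sum.inl e) b)) n (fun j => ind (orLift (U j))) =
      sahiE (bernoulliWeight (update p e c)) n (fun j => ind (U j)) := by
  rw [Sum.update_elim_inl]
  exact sahiE_orLift (update r e b) r' (update p e c) (compat_update_inl r r' p h e b c hbc) n U

/-- `E₃` of the lifted triple with the RIGHT copy of `e` frozen at `b`. [this work] -/
theorem sahiE_orLift_update_inr (r r' p : ι → unitInterval) (h : ∀ i, (1 - (r i : ℝ)) * (1 - r' i) = 1 - p i) (e : ι)
    (b c : unitInterval) (hbc : (1 - (r e : ℝ)) * (1 - b) = 1 - c) (n : ℕ) (U : Fin n → Set (Set ι)) :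
    sahiE (bernoulliWeight (update (Sum.elim r r') (Sum.inr e) b)) n (fun j => ind (orLift (U j))) =
      sahiE (bernoulliWeight (update p e c)) n (fun j => ind (U j)) := by
  rw [Sum.update_elim_inr]
  exact sahiE_orLift r (update r' e b) (update p e c) (compat_update_inr r r' p h e b c hbc) n U

/-! ### The self-improvement theorem -/

/-- **THE OR-BLOW-UP CONSEQUENCE OF THE SLICE MINIMUM PRINCIPLE.**  Assume `SliceMinimumPrinciple 3`.  Let `U₀,U₁,U₂` be
increasing events on `2^ι`, `p` a bias vector and `r, r'` splittings with `(1 − r_e)(1 − r'_e) = 1 − p_e` for every coin, at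
least one `r_i` or `r'_i` lying in `(0,1)`.  Then SOME coin `e` satisfies
`E₃(μ_{p[e↦1]}) ≤ E₃(μ_p)` or `E₃(μ_{p[e↦r'_e]}) ≤ E₃(μ_p)` or `E₃(μ_{p[e↦r_e]}) ≤ E₃(μ_p)`:
the principle applied to the OR-doubled triple, whose facets are these interior fibre values.  (With `r_e ↑ p_e`, `r'_e ↓ 0`
this yields the gradient slice principle of the memo.) [this work] -/
theorem orSlice_of_sliceMinimumPrinciple (hSMP : SliceMinimumPrinciple 3) (p r r' : ι → unitInterval)
    (h : ∀ i, (1 - (r i : ℝ)) * (1 - r' i) = 1 - p i)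
    (hlive : ∃ i, (0 < (r i : ℝ) ∧ (r i : ℝ) < 1) ∨ (0 < (r' i : ℝ) ∧ (r' i : ℝ) < 1))
    (U : Fin 3 → Set (Set ι)) (hU : ∀ j, IsUpperSet (U j)) :
    ∃ e : ι,
      sahiE (bernoulliWeight (update p e 1)) 3 (fun j => ind (U j)) ≤ sahiE (bernoulliWeight p) 3 (fun j => ind (U j)) ∨
      sahiE (bernoulliWeight (update p e (r' e))) 3 (fun j => ind (U j)) ≤ sahiE (bernoulliWeight p) 3 (fun j => ind (U j)) ∨
      sahiE (bernoulliWeight (update p e (r e))) 3 (fun j => ind (U j)) ≤ sahiE (bernoulliWeight p) 3 (fun j => ind (U j)) := by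
  -- the doubled system
  set q : ι ⊕ ι → unitInterval := Sum.elim r r' with hq
  have hlive' : (liveSet q).Nonempty := by
    obtain ⟨i, hi | hi⟩ := hlive
    · exact ⟨Sum.inl i, (mem_liveSet q (Sum.inl i)).2 (by rw [hq, Sum.elim_inl]; exact hi)⟩
    · exact ⟨Sum.inr i, (mem_liveSet q (Sum.inr i)).2 (by rw [hq, Sum.elim_inr]; exact hi)⟩
  obtain ⟨x, -, b, hb, hle⟩ := hSMP (ι ⊕ ι) q (fun j => orLift (U j)) (fun j => isUpperSet_orLift (hU j)) hlive'
  rw [hq, sahiE_orLift r r' p h 3 U] at hle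
  rcases x with e | e
  · refine ⟨e, ?_⟩
    simp only [Sum.update_elim_inl] at hle
    rcases hb with hb0 | hb1
    · -- left copy frozen at 0: macro-bias r'_e
      right; left
      have hbc : (1 - (b : ℝ)) * (1 - r' e) = 1 - r' e := by rw [hb0]; ring
      rwa [sahiE_orLift (update r e b) r' (update p e (r' e)) (compat_update_inl r r' p h e b (r' e) hbc) 3 U] at hle
    · -- left copy frozen at 1: macro-bias 1
      left
      have hbc : (1 - (b : ℝ)) * (1 - r' e) = 1 - (1 : unitInterval) := by rw [hb1, Set.Icc.coe_one]; ring
      rwa [sahiE_orLift (update r e b) r' (update p e 1) (compat_update_inl r r' p h e b 1 hbc) 3 U] at hle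
  · refine ⟨e, ?_⟩
    simp only [Sum.update_elim_inr] at hle
    rcases hb with hb0 | hb1
    · -- right copy frozen at 0: macro-bias r_e
      right; right
      have hbc : (1 - (r e : ℝ)) * (1 - b) = 1 - r e := by rw [hb0]; ring
      rwa [sahiE_orLift r (update r' e b) (update p e (r e)) (compat_update_inr r r' p h e b (r e) hbc) 3 U] at hle
    · left
      have hbc : (1 - (r e : ℝ)) * (1 - b) = 1 - (1 : unitInterval) := by rw [hb1, Set.Icc.coe_one]; ring
      rwa [sahiE_orLift r (update r' e b) (update p e 1) (compat_update_inr r r' p h e b 1 hbc) 3 U] at hle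

/-- **Refutation route (contrapositive).**  A triple of increasing events, a bias vector `p` and splittings `r, r'`
(`(1 − r_e)(1 − r'_e) = 1 − p_e`, some `r_i` or `r'_i` in `(0,1)`) such that EVERY coin `e` has all three of `E₃(μ_{p[e↦1]})`,
`E₃(μ_{p[e↦r'_e]})`, `E₃(μ_{p[e↦r_e]})` strictly above `E₃(μ_p)` would refute the slice minimum principle of order `3` — a
violation on `m` coins here is a violation of the principle itself on `2m` coins. [this work] -/
theorem not_sliceMinimumPrinciple_of_orSlice_violation (p r r' : ι → unitInterval)
    (h : ∀ i, (1 - (r i : ℝ)) * (1 - r' i) = 1 - p i)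
    (hlive : ∃ i, (0 < (r i : ℝ) ∧ (r i : ℝ) < 1) ∨ (0 < (r' i : ℝ) ∧ (r' i : ℝ) < 1))
    (U : Fin 3 → Set (Set ι)) (hU : ∀ j, IsUpperSet (U j))
    (hviol : ∀ e : ι,
      sahiE (bernoulliWeight p) 3 (fun j => ind (U j)) < sahiE (bernoulliWeight (update p e 1)) 3 (fun j => ind (U j)) ∧
      sahiE (bernoulliWeight p) 3 (fun j => ind (U j)) < sahiE (bernoulliWeight (update p e (r' e))) 3 (fun j => ind (U j)) ∧
      sahiE (bernoulliWeight p) 3 (fun j => ind (U j)) < sahiE (bernoulliWeight (update p e (r e))) 3 (fun j => ind (U j))) :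
    ¬ SliceMinimumPrinciple 3 := by
  intro hSMP
  obtain ⟨e, he⟩ := orSlice_of_sliceMinimumPrinciple hSMP p r r' h hlive U hU
  obtain ⟨h1, h2, h3⟩ := hviol e
  rcases he with he | he | he
  · exact absurd he (not_le.2 h1)
  · exact absurd he (not_le.2 h2)
  · exact absurd he (not_le.2 h3)

end SahiSliceMinimum

end Summit.CriticalPhenomena.PercolationContinuityZ3.Theorems
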